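import Literature.Geometry.Riemannian.MetricFlowFDistanceTriangle
import Literature.Geometry.Riemannian.MetricFlowCorrespondence
import HarnessLib

/-!
# The triangle inequality of the `𝔽`-distance within ONE correspondence (Bamler 2023, §5.2,
# Prop. 5.14), for `H`-concentrated metric flow pairs

R. Bamler, *Compactness theory of the space of super Ricci flows*, Invent. Math. 233 (2023), §5.2,
Proposition 5.14 (arXiv v1 Prop. 113), as printed: *"Let `(𝒳^i, (μ^i_t)_{t ∈ I'^{,i}})`,
`i = 1, 2, 3`, be three metric flow pairs over `I` that are each fully defined over `J`. Consider a
correspondence `ℭ = ((Z_t, d^Z_t)_{t ∈ I''}, (φ^i_t)_{t ∈ I''^{,i}, i = 1,2,3})` between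
`𝒳¹, 𝒳², 𝒳³` over `I'' ⊂ ℝ` that is fully defined over `J`. Then
`d^{ℭ,J}_𝔽((𝒳¹, (μ¹_t)), (𝒳³, (μ³_t))) ≤ d^{ℭ,J}_𝔽((𝒳¹, (μ¹_t)), (𝒳², (μ²_t)))
  + d^{ℭ,J}_𝔽((𝒳², (μ²_t)), (𝒳³, (μ³_t)))`."*
(The hypotheses "fully defined over `J`" are not used in the printed proof and are dropped.)

`MetricFlowFDistanceTriangle.lean` proves this for the GLUED correspondence `ℭ¹².glue ℭ²³` of two
two-flow correspondences (`FDistAdmissible.trans`, `fDistWithin_glue_le`). This file proves the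
statement as printed, for three members `P i, P j, P k` of a family `P : ι → MetricFlowPair I₀` in
ONE correspondence `ℭ : MetricFlow.FamilyCorrespondence (fun i ↦ (P i).flow) I''` between their
flows (`MetricFlowCorrespondence.lean`; the three two-flow correspondences are the restrictions
`ℭ.pair i j`, `ℭ.pair j k`, `ℭ.pair i k`, which share the comparison spaces `Z_s`):

* `kernelDistWithin_pair_le` — the pointwise triangle inequality of the integrand in `Z_s`,
  `d^{Z_s}_{W₁}((φ^i_s)_* ν^i_{xⁱ;s}, (φ^k_s)_* ν^k_{xᵏ;s}) ≤ d^{Z_s}_{W₁}((φ^i_s)_* ν^i_{xⁱ;s},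
  (φ^j_s)_* ν^j_{xʲ;s}) + d^{Z_s}_{W₁}((φ^j_s)_* ν^j_{xʲ;s}, (φ^k_s)_* ν^k_{xᵏ;s})`
  (`wassersteinW1_map_triangle`; no `H`-concentration needed);
* `FDistAdmissible.trans_pair` — **Prop. 5.14 for admissible radii**: if `r₁` is admissible for
  `d^{ℭ,J}_𝔽(P i, P j)` and `r₂` for `d^{ℭ,J}_𝔽(P j, P k)` then `r₁ + r₂` is admissible for
  `d^{ℭ,J}_𝔽(P i, P k)` (printed proof: `E¹³ := E¹² ∪ E²³`, glue `q¹²_t`, `q²³_t` along `μ²_t` by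
  `IsCoupling.exists_glue`, take the `(1, 3)`-marginal and integrate `kernelDistWithin_pair_le`;
  the integrand is Borel for `H`-concentrated flows, `measurable_kernelDistWithin`);
* `fDistWithinFamily_triangle` — **Prop. 5.14**:
  `d^{ℭ,J}_𝔽(P i, P k) ≤ d^{ℭ,J}_𝔽(P i, P j) + d^{ℭ,J}_𝔽(P j, P k)` in `[0, ∞]`
  (`MetricFlowPair.fDistWithinFamily`), for `H`-concentrated flows;
* `fDistWithinFamily_le_of_chain` — the corollary used for Cauchy sequences within a
  correspondence (§5.3, proof of Thm. 5.16 / Lemma 5.20): for a sequence `P : ℕ → MetricFlowPair I₀`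
  in one correspondence with `d^{ℭ,J}_𝔽(P n, P (n+1)) ≤ d n`, one has
  `d^{ℭ,J}_𝔽(P m, P n) ≤ ∑_{l = m}^{n - 1} d l` for `m < n`.

As in `MetricFlowFDistanceTriangle.lean`, the flows are assumed `H`-concentrated (the standing
assumption of Bamler's compactness theory) so that the integrand is Borel measurable and the
lower integrals against the glued coupling split additively.

## References

* R. H. Bamler, *Compactness theory of the space of super Ricci flows*, Invent. Math. 233 (2023),
  1121–1277 (arXiv:2008.09298), §5.1 Def. 5.5, Def. 5.6; §5.2, Prop. 5.14 (arXiv v1 Prop. 113);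
  §5.3. [Bamler2023]
-/

noncomputable section

open Set MeasureTheory Filter TopologicalSpace Function
open scoped Topology ENNReal NNReal

namespace Literature.Geometry.Riemannian

universe u

namespace MetricFlowPair

open MetricFlow

variable {ι : Type*} {I₀ I'' : Set ℝ}

/-! ### The pointwise estimate within one correspondence -/

/-- **The `W₁`-triangle inequality in the common comparison space `Z_s`** (Bamler 2023, §5.2,
proof of Prop. 5.14, the pointwise inequality under the integral): for `s ≤ t` in the three
domains `I''^{,i}`, `I''^{,j}`, `I''^{,k}` of one correspondence `ℭ` and `xⁱ ∈ 𝒳^i_t`, `xʲ ∈ 𝒳^j_t`,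
`xᵏ ∈ 𝒳^k_t`,
`d^{Z_s}_{W₁}((φ^i_s)_* νⁱ_{xⁱ;s}, (φ^k_s)_* νᵏ_{xᵏ;s})
  ≤ d^{Z_s}_{W₁}((φ^i_s)_* νⁱ_{xⁱ;s}, (φ^j_s)_* νʲ_{xʲ;s})
    + d^{Z_s}_{W₁}((φ^j_s)_* νʲ_{xʲ;s}, (φ^k_s)_* νᵏ_{xᵏ;s})`
— the triangle inequality for `d_{W₁}` between push-forwards of probability measures on the
Polish slices under the three isometric embeddings `φ^i_s, φ^j_s, φ^k_s` into the same `Z_s`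
(`wassersteinW1_map_triangle`).
[cite: Bamler2023, §5.2, Prop. 5.14 (arXiv v1 Prop. 113), proof] -/
theorem kernelDistWithin_pair_le (P : ι → MetricFlowPair.{u} I₀)
    (ℭ : FamilyCorrespondence (fun i ↦ (P i).flow) I'') {i j k : ι} {s t : ℝ}
    (hsᵢ : s ∈ ℭ.dom i) (hsⱼ : s ∈ ℭ.dom j) (hsₖ : s ∈ ℭ.dom k)
    (htᵢ : t ∈ ℭ.dom i) (htⱼ : t ∈ ℭ.dom j) (htₖ : t ∈ ℭ.dom k) (hst : s ≤ t)
    (xᵢ : (P i).flow.Slice ⟨t, (ℭ.dom_subset i htᵢ).1⟩)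
    (xⱼ : (P j).flow.Slice ⟨t, (ℭ.dom_subset j htⱼ).1⟩)
    (xₖ : (P k).flow.Slice ⟨t, (ℭ.dom_subset k htₖ).1⟩) :
    kernelDistWithin (P i) (P k) (ℭ.pair i k) hsᵢ hsₖ htᵢ htₖ (xᵢ, xₖ) ≤
      kernelDistWithin (P i) (P j) (ℭ.pair i j) hsᵢ hsⱼ htᵢ htⱼ (xᵢ, xⱼ) +
        kernelDistWithin (P j) (P k) (ℭ.pair j k) hsⱼ hsₖ htⱼ htₖ (xⱼ, xₖ) := by
  haveI := (P i).flow.isProbabilityMeasure_condKernel (s := ⟨s, (ℭ.dom_subset i hsᵢ).1⟩) xᵢ hst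
  haveI := (P j).flow.isProbabilityMeasure_condKernel (s := ⟨s, (ℭ.dom_subset j hsⱼ).1⟩) xⱼ hst
  haveI := (P k).flow.isProbabilityMeasure_condKernel (s := ⟨s, (ℭ.dom_subset k hsₖ).1⟩) xₖ hst
  exact wassersteinW1_map_triangle (ℭ.isometry i s hsᵢ) (ℭ.isometry j s hsⱼ) (ℭ.isometry k s hsₖ)
    ((P i).flow.condKernel xᵢ ⟨s, (ℭ.dom_subset i hsᵢ).1⟩)
    ((P j).flow.condKernel xⱼ ⟨s, (ℭ.dom_subset j hsⱼ).1⟩)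
    ((P k).flow.condKernel xₖ ⟨s, (ℭ.dom_subset k hsₖ).1⟩)

/-! ### Prop. 5.14: admissible radii add within one correspondence -/

/-- **Bamler 2023, Prop. 5.14 (arXiv v1 Prop. 113), for admissible radii, within one
correspondence**: if `r₁` is admissible for `d^{ℭ,J}_𝔽(P i, P j)` and `r₂` for `d^{ℭ,J}_𝔽(P j, P k)`
(in the restrictions `ℭ.pair i j`, `ℭ.pair j k` of a correspondence `ℭ` between the whole family),
then `r₁ + r₂` is admissible for `d^{ℭ,J}_𝔽(P i, P k)`, for `H`-concentrated flows. As printed: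
`E¹³ := E¹² ∪ E²³` (`|E¹³| ≤ |E¹²| + |E²³| ≤ r₁² + r₂² ≤ (r₁ + r₂)²`); for `t ∈ I'' ∖ E¹³` the
couplings `q¹²_t`, `q²³_t` glue along `μʲ_t` to a probability measure `q¹²³_t` on
`𝒳ⁱ_t × 𝒳ʲ_t × 𝒳ᵏ_t` (`IsCoupling.exists_glue`, Polish slices) whose `(1, 3)`-marginal `q¹³_t`
couples `μⁱ_t, μᵏ_t`; for `s ≤ t` in `I'' ∖ E¹³` the pointwise estimate `kernelDistWithin_pair_le`
integrates to
`∫ d_{W₁}(…ⁱ, …ᵏ) dq¹³_t ≤ ∫ d_{W₁}(…ⁱ, …ʲ) dq¹²_t + ∫ d_{W₁}(…ʲ, …ᵏ) dq²³_t ≤ r₁ + r₂`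
(the integrand being Borel, `measurable_kernelDistWithin`).
[cite: Bamler2023, §5.2, Prop. 5.14 (arXiv v1 Prop. 113)] -/
theorem FDistAdmissible.trans_pair (P : ι → MetricFlowPair.{u} I₀)
    (ℭ : FamilyCorrespondence (fun i ↦ (P i).flow) I'') {i j k : ι} {Hi Hj Hk : ℝ}
    (hHi : (P i).flow.IsHConcentrated Hi) (hHj : (P j).flow.IsHConcentrated Hj)
    (hHk : (P k).flow.IsHConcentrated Hk) {J : Set ℝ} {r₁ r₂ : ℝ}
    (h₁ : FDistAdmissible (P i) (P j) (ℭ.pair i j) J r₁)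
    (h₂ : FDistAdmissible (P j) (P k) (ℭ.pair j k) J r₂) :
    FDistAdmissible (P i) (P k) (ℭ.pair i k) J (r₁ + r₂) := by
  obtain ⟨hr₁, E₁, hEm₁, hEI₁, hJ₁, hE₁, hE₂, hvol₁, q₁, hq₁, hint₁⟩ := h₁
  obtain ⟨hr₂, E₂, hEm₂, hEI₂, hJ₂, hE₂', hE₃, hvol₂, q₂, hq₂, hint₂⟩ := h₂
  have hd₁ : I'' \ (E₁ ∪ E₂) ⊆ I'' \ E₁ := fun x hx ↦ ⟨hx.1, fun h ↦ hx.2 (Or.inl h)⟩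
  have hd₂ : I'' \ (E₁ ∪ E₂) ⊆ I'' \ E₂ := fun x hx ↦ ⟨hx.1, fun h ↦ hx.2 (Or.inr h)⟩
  -- glue the couplings `q¹²_t`, `q²³_t` along `μʲ_t`
  have hglue : ∀ t (ht : t ∈ I'' \ (E₁ ∪ E₂)),
      ∃ γ : Measure ((P j).flow.Slice ⟨t, (ℭ.dom_subset j (hE₂ (hd₁ ht))).1⟩ ×
        ((P i).flow.Slice ⟨t, (ℭ.dom_subset i (hE₁ (hd₁ ht))).1⟩ ×
          (P k).flow.Slice ⟨t, (ℭ.dom_subset k (hE₃ (hd₂ ht))).1⟩)),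
        IsProbabilityMeasure γ ∧ γ.map (fun p ↦ (p.2.1, p.1)) = q₁ t (hd₁ ht) ∧
          γ.map (fun p ↦ (p.1, p.2.2)) = q₂ t (hd₂ ht) := fun t ht ↦
    (hq₁ t (hd₁ ht)).exists_glue (hq₂ t (hd₂ ht))
  choose γ hγP hγ₁ hγ₂ using hglue
  have hvol : volume (E₁ ∪ E₂) ≤ ENNReal.ofReal ((r₁ + r₂) ^ 2) :=
    calc volume (E₁ ∪ E₂) ≤ volume E₁ + volume E₂ := measure_union_le _ _
      _ ≤ ENNReal.ofReal (r₁ ^ 2) + ENNReal.ofReal (r₂ ^ 2) := add_le_add hvol₁ hvol₂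
      _ = ENNReal.ofReal (r₁ ^ 2 + r₂ ^ 2) := (ENNReal.ofReal_add (sq_nonneg _) (sq_nonneg _)).symm
      _ ≤ ENNReal.ofReal ((r₁ + r₂) ^ 2) := ENNReal.ofReal_le_ofReal (by nlinarith [hr₁, hr₂])
  refine ⟨add_pos hr₁ hr₂, E₁ ∪ E₂, hEm₁.union hEm₂, union_subset hEI₁ hEI₂,
    fun x hx ↦ ⟨(hJ₁ hx).1, fun h ↦ h.elim (hJ₁ hx).2 (hJ₂ hx).2⟩,
    fun t ht ↦ hE₁ (hd₁ ht), fun t ht ↦ hE₃ (hd₂ ht), hvol, fun t ht ↦ (γ t ht).map Prod.snd,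
    fun t ht ↦ ?_, fun s hs t ht hst ↦ ?_⟩
  · -- the `(i, k)`-marginal of the glued coupling couples `μⁱ_t, μᵏ_t`
    haveI := hγP t ht
    have hc : IsCoupling ((P i).μ ⟨t, (ℭ.dom_subset i (hE₁ (hd₁ ht))).1⟩)
        ((P k).μ ⟨t, (ℭ.dom_subset k (hE₃ (hd₂ ht))).1⟩) ((γ t ht).map Prod.snd) := by
      refine ⟨Measure.isProbabilityMeasure_map measurable_snd.aemeasurable, ?_, ?_⟩
      · rw [Measure.fst, Measure.map_map measurable_fst measurable_snd,
          ← (hq₁ t (hd₁ ht)).2.1, ← hγ₁ t ht, Measure.fst,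
          Measure.map_map measurable_fst (measurable_snd.fst.prodMk measurable_fst)]
        rfl
      · rw [Measure.snd, Measure.map_map measurable_snd measurable_snd,
          ← (hq₂ t (hd₂ ht)).2.2, ← hγ₂ t ht, Measure.snd,
          Measure.map_map measurable_snd (measurable_fst.prodMk measurable_snd.snd)]
        rfl
    exact hc
  · -- the integral estimate for `s ≤ t`
    have hm₁ := measurable_kernelDistWithin hHi hHj (ℭ.pair i j) (hE₁ (hd₁ hs)) (hE₂ (hd₁ hs))
      (hE₁ (hd₁ ht)) (hE₂ (hd₁ ht)) hst
    have hm₂ := measurable_kernelDistWithin hHj hHk (ℭ.pair j k) (hE₂' (hd₂ hs)) (hE₃ (hd₂ hs))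
      (hE₂' (hd₂ ht)) (hE₃ (hd₂ ht)) hst
    have hP₁ : Measurable fun p : (P j).flow.Slice ⟨t, (ℭ.dom_subset j (hE₂ (hd₁ ht))).1⟩ ×
        ((P i).flow.Slice ⟨t, (ℭ.dom_subset i (hE₁ (hd₁ ht))).1⟩ ×
          (P k).flow.Slice ⟨t, (ℭ.dom_subset k (hE₃ (hd₂ ht))).1⟩) ↦ (p.2.1, p.1) :=
      measurable_snd.fst.prodMk measurable_fst
    have hP₂ : Measurable fun p : (P j).flow.Slice ⟨t, (ℭ.dom_subset j (hE₂ (hd₁ ht))).1⟩ ×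
        ((P i).flow.Slice ⟨t, (ℭ.dom_subset i (hE₁ (hd₁ ht))).1⟩ ×
          (P k).flow.Slice ⟨t, (ℭ.dom_subset k (hE₃ (hd₂ ht))).1⟩) ↦ (p.1, p.2.2) :=
      measurable_fst.prodMk measurable_snd.snd
    calc ∫⁻ p, kernelDistWithin (P i) (P k) (ℭ.pair i k) (hE₁ (hd₁ hs)) (hE₃ (hd₂ hs))
          (hE₁ (hd₁ ht)) (hE₃ (hd₂ ht)) p ∂((γ t ht).map Prod.snd)
        ≤ ∫⁻ x, kernelDistWithin (P i) (P k) (ℭ.pair i k) (hE₁ (hd₁ hs)) (hE₃ (hd₂ hs))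
            (hE₁ (hd₁ ht)) (hE₃ (hd₂ ht)) x.2 ∂(γ t ht) := lintegral_map_le _ _
      _ ≤ ∫⁻ x, (kernelDistWithin (P i) (P j) (ℭ.pair i j) (hE₁ (hd₁ hs)) (hE₂ (hd₁ hs))
              (hE₁ (hd₁ ht)) (hE₂ (hd₁ ht)) (x.2.1, x.1) +
            kernelDistWithin (P j) (P k) (ℭ.pair j k) (hE₂' (hd₂ hs)) (hE₃ (hd₂ hs))
              (hE₂' (hd₂ ht)) (hE₃ (hd₂ ht)) (x.1, x.2.2)) ∂(γ t ht) :=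
          lintegral_mono fun x ↦ kernelDistWithin_pair_le P ℭ (hE₁ (hd₁ hs)) (hE₂ (hd₁ hs))
            (hE₃ (hd₂ hs)) (hE₁ (hd₁ ht)) (hE₂ (hd₁ ht)) (hE₃ (hd₂ ht)) hst x.2.1 x.1 x.2.2
      _ = ∫⁻ x, kernelDistWithin (P i) (P j) (ℭ.pair i j) (hE₁ (hd₁ hs)) (hE₂ (hd₁ hs))
              (hE₁ (hd₁ ht)) (hE₂ (hd₁ ht)) (x.2.1, x.1) ∂(γ t ht) +
            ∫⁻ x, kernelDistWithin (P j) (P k) (ℭ.pair j k) (hE₂' (hd₂ hs)) (hE₃ (hd₂ hs))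
              (hE₂' (hd₂ ht)) (hE₃ (hd₂ ht)) (x.1, x.2.2) ∂(γ t ht) :=
          lintegral_add_left (hm₁.comp hP₁) _
      _ = ∫⁻ p, kernelDistWithin (P i) (P j) (ℭ.pair i j) (hE₁ (hd₁ hs)) (hE₂ (hd₁ hs))
              (hE₁ (hd₁ ht)) (hE₂ (hd₁ ht)) p ∂(q₁ t (hd₁ ht)) +
            ∫⁻ p, kernelDistWithin (P j) (P k) (ℭ.pair j k) (hE₂' (hd₂ hs)) (hE₃ (hd₂ hs))
              (hE₂' (hd₂ ht)) (hE₃ (hd₂ ht)) p ∂(q₂ t (hd₂ ht)) := by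
          rw [← hγ₁ t ht, ← hγ₂ t ht, lintegral_map hm₁ hP₁, lintegral_map hm₂ hP₂]
      _ ≤ ENNReal.ofReal r₁ + ENNReal.ofReal r₂ :=
          add_le_add (hint₁ s (hd₁ hs) t (hd₁ ht) hst) (hint₂ s (hd₂ hs) t (hd₂ ht) hst)
      _ = ENNReal.ofReal (r₁ + r₂) := (ENNReal.ofReal_add hr₁.le hr₂.le).symm

/-! ### Prop. 5.14 -/

/-- **Bamler 2023, Prop. 5.14 (arXiv v1 Prop. 113): the triangle inequality of the `𝔽`-distance
within one correspondence**, `d^{ℭ,J}_𝔽(P i, P k) ≤ d^{ℭ,J}_𝔽(P i, P j) + d^{ℭ,J}_𝔽(P j, P k)` in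
`[0, ∞]`, for three `H`-concentrated members `P i, P j, P k` of a family of metric flow pairs in a
correspondence `ℭ` between their flows (`MetricFlowPair.fDistWithinFamily`): admissible radii add
(`FDistAdmissible.trans_pair`), take infima (`ENNReal.le_iInf_add_iInf`). The `H`-concentration
(all flows of Bamler's compactness theory are `H`-concentrated) makes the integrand Borel; see the
module docstring. [cite: Bamler2023, §5.2, Prop. 5.14 (arXiv v1 Prop. 113)] -/
theorem fDistWithinFamily_triangle (P : ι → MetricFlowPair.{u} I₀)
    (ℭ : FamilyCorrespondence (fun i ↦ (P i).flow) I'') (i j k : ι)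
    (hHi : ∃ H, (P i).flow.IsHConcentrated H) (hHj : ∃ H, (P j).flow.IsHConcentrated H)
    (hHk : ∃ H, (P k).flow.IsHConcentrated H) (J : Set ℝ) :
    fDistWithinFamily P ℭ i k J ≤ fDistWithinFamily P ℭ i j J + fDistWithinFamily P ℭ j k J := by
  obtain ⟨Hi, hHi⟩ := hHi
  obtain ⟨Hj, hHj⟩ := hHj
  obtain ⟨Hk, hHk⟩ := hHk
  refine ENNReal.le_iInf_add_iInf fun r₁ r₂ ↦ ENNReal.le_iInf_add_iInf fun h₁ h₂ ↦ ?_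
  rw [← ENNReal.ofReal_add h₁.1.le h₂.1.le]
  exact fDistWithin_le (FDistAdmissible.trans_pair P ℭ hHi hHj hHk h₁ h₂)

/-! ### Chains: `d^{ℭ,J}_𝔽(P m, P n) ≤ ∑_{m ≤ l < n} d^{ℭ,J}_𝔽(P l, P (l+1))` -/

/-- **The triangle inequality along a chain within one correspondence** (the use of Prop. 5.14 in
Bamler 2023, §5.3, for Cauchy sequences within a correspondence): for a sequence of
`H`-concentrated metric flow pairs `P n`, `n ∈ ℕ`, in one correspondence `ℭ` between their flows
with `d^{ℭ,J}_𝔽(P n, P (n + 1)) ≤ d n`, one has `d^{ℭ,J}_𝔽(P m, P n) ≤ ∑_{l ∈ [m, n)} d l` for all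
`m < n` (induction on `n` with `fDistWithinFamily_triangle`; the case `m = n` is not claimed).
[cite: Bamler2023, §5.2, Prop. 5.14 (arXiv v1 Prop. 113); §5.3] -/
theorem fDistWithinFamily_le_of_chain (P : ℕ → MetricFlowPair.{u} I₀)
    (ℭ : FamilyCorrespondence (fun n ↦ (P n).flow) I'')
    (hP : ∀ n, ∃ H, (P n).flow.IsHConcentrated H)
    {J : Set ℝ} {d : ℕ → ℝ≥0∞} (hd : ∀ n, fDistWithinFamily P ℭ n (n + 1) J ≤ d n) :
    ∀ m n, m < n → fDistWithinFamily P ℭ m n J ≤ ∑ l ∈ Finset.Ico m n, d l := by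
  intro m n hmn
  change m + 1 ≤ n at hmn
  induction n, hmn using Nat.le_induction with
  | base =>
      rw [Nat.Ico_succ_singleton, Finset.sum_singleton]
      exact hd m
  | succ n hmn ih =>
      rw [Finset.sum_Ico_succ_top (Nat.le_of_succ_le hmn)]
      exact (fDistWithinFamily_triangle P ℭ m n (n + 1) (hP m) (hP n) (hP (n + 1)) J).trans
        (add_le_add ih (hd n))

end MetricFlowPair

end Literature.Geometry.Riemannian

end
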